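import Summits.CriticalPhenomena.SAWScalingLimit.Theorems.SAWLoopFugacityFlowSimpleSubseqLimitsTransferCore
import Summits.CriticalPhenomena.SAWScalingLimit.Theorems.SAWLoopFugacityFlowSimpleSubseqLimitsRouteResidual
import HarnessLib

/-!
# Line `slit-continuous-restriction` of the crux `SimpleSubseqLimits` (stmt-CriticalPhenomena-4982,
# decl `Summit.CriticalPhenomena.SAWScalingLimit.Theses.SAWLoopFugacityFlow.SimpleSubseqLimits`):
# the crux CLOSED MODULO ITS ONE OPEN INPUT

The line (idea card `Cruxes/SimpleSubseqLimits/Ideas/slit-continuous-restriction.md`, strategist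
skeleton s1, lead c9) replaces the engine-less averaged lattice residual `PastFutureAvoidance` of the
ten earlier seats by the CONDITIONAL, sequence-continuous input `Transfer.SequentialSlitAvoidance`
(first-entrance far-slit avoidance given the prefix, pointwise in the ADMISSIBLE limit past, stated on
the original critical law; the value-free shadow of the A-side made continuous along slit domains),
and proves everything else:

* `core_of_farReturnNull` — far-return nullity + hull-avoidance values ⇒ the CORE of the crux
  (guarded Rohde–Schramm closing `FarPast.Passage.mem_simple_of_forall_notMem_farReturnEvent`, SHAPE
  `PastShadowing.Main.rangeArc_of_avoidanceValues`, free endpoint clauses);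
* `core_of_seqSlitAvoidance : SequentialSlitAvoidance → AvoidanceValues → SimpleSubseqLimitsCore` —
  ROUTE-NEUTRAL closing through the six landed stubs `Lattice.stub_latticeBound` (p149500),
  `Timing.stub_prefixTiming` (p150768), `Pasts.stub_pastsCompact` (p151879), `Arc.stub_subArc`
  (p151729), `Transfer.stub_transferCore` (p153873), `Endpoints.stub_endpoints` (p151709);
* `line_slitContinuousRestriction : SequentialSlitAvoidance → AvoidanceLimit → SimpleSubseqLimits` —
  the crux BY NAME from the open input and the route's own A-side crux `AvoidanceLimit`
  (stmt-CriticalPhenomena-10649; SHAPE via `RouteResidual.avoidanceValues_of_avoidanceLimit`).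

So inside route SAWLoopFugacityFlow (and, through `core_of_seqSlitAvoidance`, inside every route that
delivers `AvoidanceValues`) the crux stmt-4982 now hinges on `SequentialSlitAvoidance` ALONE.
-/

noncomputable section

open MeasureTheory Filter Topology Set Metric Function
open Literature.Probability.RandomPlanarGeometry Literature.Probability.RandomPlanarGeometry.SAW
open Literature.Probability.LatticeModels
open scoped ENNReal NNReal BoundedContinuousFunction unitInterval

namespace Summit.CriticalPhenomena.SAWScalingLimit.Theorems.SimpleSubseqLimits.SlitRestriction.Line

open Summit.CriticalPhenomena.SAWScalingLimit.Theses.SAWLoopFugacityFlow (SimpleSubseqLimits AvoidanceLimit)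
open Summit.CriticalPhenomena.SAWScalingLimit.Theorems.SimpleSubseqLimits.Negative
  (SimpleSubseqLimitsCore simpleSubseqLimits_iff_core ae_source_target_range_of_weakLimitAlong)
open Summit.CriticalPhenomena.SAWScalingLimit.Theorems.SimpleSubseqLimits.MarkedPointRevisit.Passage
  (IsSubseqLimit)
open Summit.CriticalPhenomena.SAWScalingLimit.Theorems.SimpleSubseqLimits.FirstHit.Passage
  (gaussRat countable_gaussRat)
open Summit.CriticalPhenomena.SAWScalingLimit.Theorems.SimpleSubseqLimits.FarPast.Passage
  (farReturnEvent mem_simple_of_forall_notMem_farReturnEvent)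
open Summit.CriticalPhenomena.SAWScalingLimit.Theorems.SimpleSubseqLimits.PastShadowing.Main
  (AvoidanceValues rangeArc_of_avoidanceValues)
open Summit.CriticalPhenomena.SAWScalingLimit.Theorems.SimpleSubseqLimits.FarPast.RouteResidual
  (avoidanceValues_of_avoidanceLimit)
open Summit.CriticalPhenomena.SAWScalingLimit.Theorems.SimpleSubseqLimits.SlitRestriction.Lattice
  (stub_latticeBound)
open Summit.CriticalPhenomena.SAWScalingLimit.Theorems.SimpleSubseqLimits.SlitRestriction.Timing
  (stub_prefixTiming)
open Summit.CriticalPhenomena.SAWScalingLimit.Theorems.SimpleSubseqLimits.SlitRestriction.Pasts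
  (stub_pastsCompact)
open Summit.CriticalPhenomena.SAWScalingLimit.Theorems.SimpleSubseqLimits.SlitRestriction.Arc
  (stub_subArc)
open Summit.CriticalPhenomena.SAWScalingLimit.Theorems.SimpleSubseqLimits.SlitRestriction.Endpoints
  (FarReturnNull stub_endpoints)
open Summit.CriticalPhenomena.SAWScalingLimit.Theorems.SimpleSubseqLimits.SlitRestriction.Transfer
  (SequentialSlitAvoidance stub_transferCore)

/-- **Far-return nullity and the hull-avoidance values of subsequential limits give the CORE of the crux**
(`Negative.SimpleSubseqLimitsCore`: `ν`-a.e. simple ∧ boundary clause). Simplicity `ν`-a.e.: the countably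
many far-return events with Gaussian-rational centre and positive rational radius are null, the endpoints
`a ≠ b` are free (`Negative.ae_source_target_range_of_weakLimitAlong`), and the guarded Rohde–Schramm
closing `FarPast.Passage.mem_simple_of_forall_notMem_farReturnEvent` applies; the boundary clause `ν`-a.e.
from SHAPE (`PastShadowing.Main.rangeArc_of_avoidanceValues`). [folklore] -/
theorem core_of_farReturnNull (hN : FarReturnNull) (hAV : AvoidanceValues) : SimpleSubseqLimitsCore := by
  intro D a b hab s ν hs hν hw
  haveI := hν
  have hL : IsSubseqLimit D a b s ν := ⟨hs, hν, hw⟩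
  have hfree := ae_source_target_range_of_weakLimitAlong (ν := ν) hab hs hw
  haveI : Countable gaussRat := countable_gaussRat.to_subtype
  have hnull : ∀ᵐ c ∂ν, ∀ q : gaussRat, ∀ r : {x : ℚ // 0 < x},
      c ∉ farReturnEvent (q : ℂ) (r : ℚ) := by
    rw [ae_all_iff]; intro q
    rw [ae_all_iff]; intro r
    have hr : (0 : ℝ) < ((r : ℚ) : ℝ) := by exact_mod_cast r.2
    exact measure_eq_zero_iff_ae_notMem.1 (hN D a b s ν hab hL q _ hr)
  have hshape := rangeArc_of_avoidanceValues hAV D a b hab s ν hs hν hw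
  filter_upwards [hfree, hnull, hshape] with c hc hn h2
  refine ⟨mem_simple_of_forall_notMem_farReturnEvent c (fun q hq r hr => ?_) ?_, h2.2⟩
  · exact hn ⟨q, hq⟩ ⟨r, hr⟩
  · rw [hc.1, hc.2.1]
    exact fun h => absurd (D.pt_injective h) (by decide)

/-- **Route-neutral closing of the line**: sequential slit avoidance and the hull-avoidance values of
subsequential limits give the CORE of the crux, through the six landed stubs of the line. [folklore] -/
theorem core_of_seqSlitAvoidance (h₁ : SequentialSlitAvoidance) (hAV : AvoidanceValues) :
    SimpleSubseqLimitsCore :=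
  core_of_farReturnNull (stub_endpoints (stub_transferCore stub_latticeBound stub_prefixTiming
    stub_pastsCompact stub_subArc h₁ hAV)) hAV

/-- **LINE `slit-continuous-restriction` (registered stub `line_slitContinuousRestriction` of crux
stmt-CriticalPhenomena-4982): the crux BY NAME from its one open input and the route's A-side crux.**
`SequentialSlitAvoidance → AvoidanceLimit → SimpleSubseqLimits`. [folklore] -/
theorem line_slitContinuousRestriction : SequentialSlitAvoidance → AvoidanceLimit → SimpleSubseqLimits :=
  fun h₁ hA => simpleSubseqLimits_iff_core.2
    (core_of_seqSlitAvoidance h₁ (avoidanceValues_of_avoidanceLimit hA))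

end Summit.CriticalPhenomena.SAWScalingLimit.Theorems.SimpleSubseqLimits.SlitRestriction.Line

end
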